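import Summits.QuantumAdvantage.QuantumAdvantage.Theorems.MobiusLadderLiouvilleOrthogonalTC0StubDepthTwoNf
import HarnessLib

/-!
# Crux `MobiusLadder.LiouvilleOrthogonalTC0` (stmt-QuantumAdvantage-1393), line `Sketch`, skeleton v6:
# the depth-two normal form with a SYNTACTIC side condition — `∧/∨`-top circuits are ORs of tests

Companion of `stub_depthTwo_nf` (`…StubDepthTwoNf.lean`, whose conclusion is a disjunction OR-form /
MAJ-form chosen by the proof). Here the OR-form is forced by a syntactic hypothesis on the circuit:
if every MAJORITY gate of a `tcBasis` circuit of `acDepth ≤ 2` sits at `acWeight`-depth `≤ 1`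
(so the output is, under free negations, an `∧ₖ`/`∨ₖ` gate over threshold gates and literals, or a
single threshold gate), then the circuit computes `b ⊕ [∃ a < K, t_a ≤ Σ_i w_{a,i} x_i]` with
`K ≤ size + n` integer tests. This is the hypothesis under which the Kane rung
(`liouville_orthogonal_orLtf`) applies in circuit language (`…DepthTwoAndOr.lean`).

* `DepthTwoOrNf.wire_or_nf` — the wire invariant (reverse induction on the program, reusing
  `DepthTwoNf.or_tests`, `DepthOneLtf.wire_invariant`);
* `depthTwo_or_nf` — the circuit statement.
-/

set_option linter.dupNamespace false -- D-0017: single-problem summit ⇒ `QuantumAdvantage.QuantumAdvantage` by design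

namespace Summit.QuantumAdvantage.QuantumAdvantage.Theorems.LiouvilleOrthogonalTC0

open Finset
open Literature.Computability.Complexity
open Literature.Computability.Complexity.GateList

namespace DepthTwoOrNf

variable {n : ℕ}

/-- A single integer linear threshold test is an OR of one test. -/
theorem or_nf_of_ltf {f : (Fin n → Bool) → Bool} {M : ℕ} (hM : 1 ≤ M)
    (hf : ∃ (w : Fin n → ℤ) (θ : ℤ), ∀ x : Fin n → Bool,
      f x = decide (θ ≤ ∑ j, w j * (if x j then (1 : ℤ) else 0))) :
    ∃ (K : ℕ) (b : Bool) (w : Fin K → Fin n → ℤ) (t : Fin K → ℤ), K ≤ M ∧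
      ∀ x : Fin n → Bool, f x = xor b (decide (∃ a : Fin K,
          t a ≤ ∑ i, w a i * (if x i then (1 : ℤ) else 0))) := by
  obtain ⟨w, θ, hf⟩ := hf
  refine ⟨1, false, fun _ => w, fun _ => θ, hM, fun x => ?_⟩
  rw [hf x, DepthTwoNf.xor_false_left, decide_eq_decide]
  exact ⟨fun h => ⟨0, h⟩, fun ⟨_, h⟩ => h⟩

/-- The depths of the gates of a prefix are unchanged by appending a gate. -/
theorem getD_wdepths_append_left (gs : List (Gate (Fin n))) (g : Gate (Fin n)) {j : ℕ}
    (hj : j < gs.length) :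
    (wdepths acWeight (gs ++ [g])).getD j 0 = (wdepths acWeight gs).getD j 0 := by
  rw [wdepths_append_singleton, List.getD_eq_getElem?_getD, List.getD_eq_getElem?_getD,
    List.getElem?_append_left (by simpa using hj)]

/-- The side condition "every majority gate has depth `≤ 1`" passes to prefixes of the program. -/
theorem majShallow_prefix (gs : List (Gate (Fin n))) (g : Gate (Fin n))
    (hM : ∀ (j : ℕ) (hj : j < (gs ++ [g]).length), (∃ k, ((gs ++ [g])[j]).fn = GateFn.maj k) →
      (wdepths acWeight (gs ++ [g])).getD j 0 ≤ 1) :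
    ∀ (j : ℕ) (hj : j < gs.length), (∃ k, (gs[j]).fn = GateFn.maj k) →
      (wdepths acWeight gs).getD j 0 ≤ 1 := by
  intro j hj hmaj
  have hj' : j < (gs ++ [g]).length := by simp; omega
  have h := hM j hj' (by rwa [List.getElem_append_left hj])
  rwa [getD_wdepths_append_left gs g hj] at h

/-- **The wire invariant, OR-form.** In a well-formed program over `tcBasis` all of whose majority
gates have `acWeight`-depth `≤ 1`, every valid wire of depth `≤ 2` carries `b ⊕ (OR of ≤ #gates + n
integer tests)`. -/
theorem wire_or_nf (gs : List (Gate (Fin n))) (hwf : WF gs) (hB : ∀ g ∈ gs, g.fn ∈ tcBasis)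
    (hM : ∀ (j : ℕ) (hj : j < gs.length), (∃ k, (gs[j]).fn = GateFn.maj k) →
      (wdepths acWeight gs).getD j 0 ≤ 1)
    (u : Fin n ⊕ ℕ) (hu : OutOK gs.length u) (hd : wireDepthOf (wdepths acWeight gs) u ≤ 2) :
    ∃ (K : ℕ) (b : Bool) (w : Fin K → Fin n → ℤ) (t : Fin K → ℤ), K ≤ gs.length + n ∧
      ∀ x : Fin n → Bool, wireOf x (vals gs x) u = xor b (decide (∃ a : Fin K,
          t a ≤ ∑ i, w a i * (if x i then (1 : ℤ) else 0))) := by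
  induction gs using List.reverseRecOn generalizing u with
  | nil =>
    cases u with
    | inl i =>
      exact or_nf_of_ltf (by simp only [List.length_nil, Nat.zero_add]; exact Fin.pos i)
        (by simpa only [wireOf_inl] using DepthOneLtf.ltf_input i)
    | inr m => exact absurd (hu m rfl) (Nat.not_lt_zero m)
  | append_singleton gs g ih =>
    have hwf' : WF gs := hwf.of_append_left
    have hB' : ∀ g' ∈ gs, g'.fn ∈ tcBasis := fun g' hg' => hB g' (List.mem_append_left _ hg')
    have hgB : g.fn ∈ tcBasis := hB g (List.mem_append_right _ (List.mem_singleton_self g))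
    have hOK : GateOK gs.length g := hwf.getLast
    have hargs : ∀ a, OutOK gs.length (g.args a) := fun a m h => hOK a m h
    have hM' := majShallow_prefix gs g hM
    have hlen : gs.length + n ≤ (gs ++ [g]).length + n := by
      simp only [List.length_append, List.length_singleton]; omega
    cases u with
    | inl i =>
      exact or_nf_of_ltf (by simp only [List.length_append, List.length_singleton]; omega)
        (by simpa only [wireOf_inl] using DepthOneLtf.ltf_input i)
    | inr m =>
      have hm : m < gs.length + 1 := by simpa using hu m rfl
      rcases Nat.lt_succ_iff_lt_or_eq.1 hm with hlt | rfl
      · -- a gate of the prefix: values and depths are unchanged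
        have hu' : OutOK gs.length (.inr m : Fin n ⊕ ℕ) := fun m' h => by cases h; exact hlt
        have hval : ∀ x, wireOf x (vals (gs ++ [g]) x) (.inr m) = wireOf x (vals gs x) (.inr m) :=
          fun x => wireOf_vals_append gs [g] x _ hu'
        have hdep : wireDepthOf (wdepths acWeight (gs ++ [g])) (.inr m : Fin n ⊕ ℕ) =
            wireDepthOf (wdepths acWeight gs) (.inr m) :=
          wireDepthOf_wdepths_append acWeight gs [g] _ hu'
        rw [hdep] at hd
        simp only [hval]
        obtain ⟨K, b, w, t, hK, h⟩ := ih hwf' hB' hM' _ hu' hd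
        exact ⟨K, b, w, t, hK.trans hlen, h⟩
      · -- the new gate: first the case of depth `≤ 1` (in particular every `MAJ` gate)
        by_cases hd1 : wireDepthOf (wdepths acWeight (gs ++ [g])) (.inr gs.length : Fin n ⊕ ℕ) ≤ 1
        · exact or_nf_of_ltf (by simp only [List.length_append, List.length_singleton]; omega)
            ((DepthOneLtf.wire_invariant (gs ++ [g]) hwf hB _ hu).2 hd1)
        have hval : ∀ x, wireOf x (vals (gs ++ [g]) x) (.inr gs.length) =
            g.op (fun a => wireOf x (vals gs x) (g.args a)) :=
          fun x => by rw [wireOf_inr, getD_vals_append_singleton]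
        have hdep : wireDepthOf (wdepths acWeight (gs ++ [g])) (.inr gs.length : Fin n ⊕ ℕ) =
            acWeight g.fn + univ.sup fun a => wireDepthOf (wdepths acWeight gs) (g.args a) := by
          rw [wireDepthOf_inr, getD_wdepths_append_singleton]
        have hle : ∀ a, wireDepthOf (wdepths acWeight gs) (g.args a) ≤
            univ.sup fun a => wireDepthOf (wdepths acWeight gs) (g.args a) := fun a =>
          Finset.le_sup (f := fun a => wireDepthOf (wdepths acWeight gs) (g.args a)) (mem_univ a)
        -- the gate is not a majority gate (those have depth `≤ 1` by `hM`)
        have hnmaj : ∀ k, g.fn ≠ GateFn.maj k := by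
          intro k hk
          apply hd1
          have hj : gs.length < (gs ++ [g]).length := by simp
          have h := hM gs.length hj ⟨k, by simpa using hk⟩
          rwa [wireDepthOf_inr]
        rw [hdep] at hd hd1
        simp only [hval]
        by_cases hnot : g.fn = GateFn.not
        · -- a `¬` gate on a wire of depth `≤ 2`: flip the sign
          obtain ⟨a₀, hop⟩ := DepthOneLtf.op_eq_not_of_fn_eq_not g hnot
          have ha0 : wireDepthOf (wdepths acWeight gs) (g.args a₀) ≤ 2 := by
            have := hle a₀
            omega
          simp only [hop]
          obtain ⟨K, b, w, t, hK, h⟩ := ih hwf' hB' hM' (g.args a₀) (hargs a₀) ha0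
          exact ⟨K, !b, w, t, hK.trans hlen, fun x => by rw [h x, DepthTwoNf.not_xor_eq]⟩
        · -- an `∧ₖ / ∨ₖ` gate (weight `1`) on wires of depth `≤ 1`, i.e. on integer tests
          have hd1' : ∀ a, wireDepthOf (wdepths acWeight gs) (g.args a) ≤ 1 := by
            intro a
            have hw1 : acWeight g.fn = 1 := by simp [acWeight, hnot]
            have := hle a
            omega
          have hL : ∀ a, ∃ (w : Fin n → ℤ) (θ : ℤ), ∀ x : Fin n → Bool,
              wireOf x (vals gs x) (g.args a) = decide (θ ≤ ∑ j, w j * (if x j then (1 : ℤ) else 0)) :=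
            fun a => (DepthOneLtf.wire_invariant gs hwf' hB' (g.args a) (hargs a)).2 (hd1' a)
          rcases (mem_tcBasis_iff g.fn).1 hgB with h | ⟨k, h | h | h⟩
          · exact absurd h hnot
          · -- `∧ₖ`: De Morgan
            obtain ⟨w, t, hw⟩ := DepthTwoNf.or_tests (fun u x => !wireOf x (vals gs x) u) g.args hargs
              (fun a => DepthOneLtf.ltf_not (hL a))
            refine ⟨gs.length + n, true, w, t, hlen, fun x => ?_⟩
            rw [DepthTwoNf.op_of_fn_eq_and g h, DepthTwoNf.xor_true_left, ← hw x, Bool.eq_iff_iff]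
            simp
          · -- `∨ₖ`
            obtain ⟨w, t, hw⟩ := DepthTwoNf.or_tests (fun u x => wireOf x (vals gs x) u) g.args hargs hL
            exact ⟨gs.length + n, false, w, t, hlen, fun x => by
              rw [DepthTwoNf.op_of_fn_eq_or g h, DepthTwoNf.xor_false_left, hw x]⟩
          · exact absurd h (hnmaj k)

end DepthTwoOrNf

/-- **The depth-two normal form, OR-form under a syntactic side condition.** A circuit over `tcBasis`
with `acDepth ≤ 2` all of whose MAJORITY gates sit at `acWeight`-depth `≤ 1` (i.e. whose top
non-negation gate, if at depth two, is `∧ₖ` or `∨ₖ`) computes `b ⊕ [∃ a < K, t_a ≤ Σ_i w_{a,i} x_i]`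
for some `K ≤ size + n` integer linear threshold tests and a sign `b`. -/
theorem depthTwo_or_nf {n : ℕ} (C : Circuit (Fin n)) (hB : C.IsOver tcBasis) (hd : C.acDepth ≤ 2)
    (hM : ∀ (j : ℕ) (hj : j < C.gates.length), (∃ k, (C.gates[j]).fn = GateFn.maj k) →
      (wdepths acWeight C.gates).getD j 0 ≤ 1) :
    ∃ (K : ℕ) (b : Bool) (w : Fin K → Fin n → ℤ) (t : Fin K → ℤ), K ≤ C.size + n ∧
      ∀ x : Fin n → Bool, C.eval x = xor b (decide (∃ a : Fin K,
          t a ≤ ∑ i, w a i * (if x i then (1 : ℤ) else 0))) := by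
  rw [Circuit.acDepth, circuit_depthWith] at hd
  obtain ⟨K, b, w, t, hK, h⟩ :=
    DepthTwoOrNf.wire_or_nf C.gates (wf_gates C) hB hM C.output C.wf_output hd
  refine ⟨K, b, w, t, hK, ?_⟩
  simp only [circuit_eval]
  exact h

end Summit.QuantumAdvantage.QuantumAdvantage.Theorems.LiouvilleOrthogonalTC0

namespace Summit.QuantumAdvantage.QuantumAdvantage.Theorems.LiouvilleOrthogonalTC0

open Finset
open Literature.Computability.Complexity
open Literature.Computability.Complexity.GateList

/-- **Registered stub `stub_depthTwoOrNf`** (line `Sketch`, v6, lead c4): verbatim `depthTwo_or_nf`. -/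
theorem stub_depthTwoOrNf {n : ℕ} (C : Circuit (Fin n)) (hB : C.IsOver tcBasis) (hd : C.acDepth ≤ 2) (hM : ∀ (j : ℕ) (hj : j < C.gates.length), (∃ k, (C.gates[j]).fn = GateFn.maj k) → (wdepths acWeight C.gates).getD j 0 ≤ 1) : ∃ (K : ℕ) (b : Bool) (w : Fin K → Fin n → ℤ) (t : Fin K → ℤ), K ≤ C.size + n ∧ ∀ x : Fin n → Bool, C.eval x = xor b (decide (∃ a : Fin K, t a ≤ ∑ i, w a i * (if x i then (1 : ℤ) else 0))) :=
  depthTwo_or_nf C hB hd hM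

end Summit.QuantumAdvantage.QuantumAdvantage.Theorems.LiouvilleOrthogonalTC0
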